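/-
Copyright (c) 2026. All rights reserved.
Released under Apache 2.0 license as described in the file LICENSE.
-/
import Summits.AtomisticToContinuum.Crystallization.Theorems.OverbindingBudgetAffineFarSlotRecord

/-!
# Overbinding budget — R_aff′ brick FRAME: exact realisation of approximate label equations on a half-frame `(f, c₁, c₂)`

Slot Z of `stmt-AtomisticToContinuum-31280`, leaf `…FarSmoothSplit.AffineChartStraightening'` (R_aff′), radial development (g59
memo §3).  At a new adjacency `(j, k)` the comparison map `L = G_j⁻¹ G_k` of the two affine frames satisfies the label equations
`L f ≈ −e`, `L cᵢ ≈ dᵢ − e` to accuracy `η = O(ε₁)`, where `f` is the label of `j` seen from `k` and `c₁, c₂` an independent pair of the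
common shell of `f` (`‖cᵢ‖ = ‖cᵢ − f‖ = 1`, `⟪c₁, c₂⟫ ∈ {1/2, 0}`; `exists_goodPair`).  **FRAME** (`frameRealisation_holds`): there is a
linear `M` satisfying the three equations EXACTLY with `‖M v − L v‖ ≤ 4η‖v‖`.  Consequently `M` inherits near-conformality from `L`
(`nearConformal_of_frame`), `snapRigidity_pair` makes `M` a linear isometry, EXT extends it to the whole common shell and COMPAT
propagates exact positions.  (FRAME + `snapRigidity_pair` + EXT replace brick R0 `LabelAffineConsistency` of the g59 design memo.)

Proof: `M = L + Σᵢ ⟪bᵢ♯, ·⟫ (tᵢ − L bᵢ)` with the EXPLICIT dual basis of `(f, c₁, c₂)` (Gram inverse: `g = ⟪c₁,c₂⟫`, `2g² = g`):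
`b₀♯ = (2−g)f − (1−g)(c₁ + c₂)`, `b₁♯ = −(1−g)f + 3/2 c₁ + (1/2 − 2g)c₂`, `b₂♯` symmetric; `‖b₀♯‖² = 2 − g ≤ 9/4`,
`‖b₁♯‖² = ‖b₂♯‖² = 3/2 ≤ 25/16`, so `Σ‖bᵢ♯‖ ≤ 4` (`halfFrame_duals`, with the expansion `v = Σ ⟪bᵢ♯, v⟫ bᵢ`); hence the
inverse-free CONDITIONING form `halfFrame_opNorm_le`: a linear map `η`-small on a half-frame is `4η`-small (used in the development as
`‖G_j (M v) − G_k v‖ ≤ 4η‖v‖` for the exact pattern-side relabelling `M`).  Pure linear algebra in `E³`; no pattern facts.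
-/

namespace Summit.AtomisticToContinuum.Crystallization.Theorems.OverbindingBudgetAffineFarSmoothSplit

open scoped RealInnerProductSpace

/-! ## §1  The brick -/

/-- **FRAME · EXACT REALISATION ON A HALF-FRAME.**  Approximate label equations on `(f, c₁, c₂)` (a unit vector and an independent
pair of its common shell) are satisfied exactly by a linear map `4η`-close to `L` in operator norm. [this file; g59 memo §3] -/
def FrameRealisation : Prop :=
  ∀ (f c₁ c₂ : EuclideanSpace ℝ (Fin 3)), ‖f‖ = 1 → ‖c₁‖ = 1 → ‖c₂‖ = 1 → ‖c₁ - f‖ = 1 → ‖c₂ - f‖ = 1 →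
    (⟪c₁, c₂⟫ = 1 / 2 ∨ ⟪c₁, c₂⟫ = 0) →
      ∀ (L : EuclideanSpace ℝ (Fin 3) →ₗ[ℝ] EuclideanSpace ℝ (Fin 3)) (t₀ t₁ t₂ : EuclideanSpace ℝ (Fin 3)) (η : ℝ),
        ‖L f - t₀‖ ≤ η → ‖L c₁ - t₁‖ ≤ η → ‖L c₂ - t₂‖ ≤ η →
          ∃ M : EuclideanSpace ℝ (Fin 3) →ₗ[ℝ] EuclideanSpace ℝ (Fin 3),
            M f = t₀ ∧ M c₁ = t₁ ∧ M c₂ = t₂ ∧ ∀ v, ‖M v - L v‖ ≤ 4 * η * ‖v‖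

/-! ## §2  Rank-one corrections and the proof -/

/-- The rank-one linear map `v ↦ ⟪b, v⟫ • w`. [this file] -/
noncomputable def dualSmul (b w : EuclideanSpace ℝ (Fin 3)) : EuclideanSpace ℝ (Fin 3) →ₗ[ℝ] EuclideanSpace ℝ (Fin 3) where
  toFun v := ⟪b, v⟫ • w
  map_add' x y := by simp only [inner_add_right, add_smul]
  map_smul' r x := by simp only [real_inner_smul_right, RingHom.id_apply, smul_smul]

/-- `dualSmul b w v = ⟪b, v⟫ • w`. [formal bookkeeping] -/
@[simp] theorem dualSmul_apply (b w v : EuclideanSpace ℝ (Fin 3)) : dualSmul b w v = ⟪b, v⟫ • w := rfl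

/-- `‖x‖ = ‖g‖ = ‖x − g‖ = 1 ⟹ ⟪x, g⟫ = 1/2`. [folklore] -/
theorem real_inner_eq_half {x g : EuclideanSpace ℝ (Fin 3)} (hx : ‖x‖ = 1) (hg : ‖g‖ = 1) (hxg : ‖x - g‖ = 1) :
    ⟪x, g⟫ = 1 / 2 := by
  have h := norm_sub_sq_real x g
  rw [hxg, hx, hg] at h
  linarith

-- `le_of_sq_le_sq'` is landed elsewhere (gate dedup); Mathlib's `abs_le_of_sq_le_sq'` is used instead.

/-- **The dual half-frame.**  For a half-frame `(f, c₁, c₂)` there are dual vectors `b₀, b₁, b₂` (`⟪bᵢ, ·⟫` = the coordinate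
functionals) with `‖b₀‖ ≤ 3/2`, `‖b₁‖, ‖b₂‖ ≤ 5/4`, and every `v` expands as `v = ⟪b₀,v⟫ f + ⟪b₁,v⟫ c₁ + ⟪b₂,v⟫ c₂`.  Explicitly
`b₀ = (2−g)f − (1−g)(c₁ + c₂)`, `b₁ = −(1−g)f + 3/2 c₁ + (1/2−2g) c₂` (`g = ⟪c₁,c₂⟫`, `2g² = g`). [this file] -/
theorem halfFrame_duals {f c₁ c₂ : EuclideanSpace ℝ (Fin 3)} (hf : ‖f‖ = 1) (hc₁ : ‖c₁‖ = 1) (hc₂ : ‖c₂‖ = 1)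
    (hc₁f : ‖c₁ - f‖ = 1) (hc₂f : ‖c₂ - f‖ = 1) (hg : ⟪c₁, c₂⟫ = 1 / 2 ∨ ⟪c₁, c₂⟫ = 0) :
    ∃ b₀ b₁ b₂ : EuclideanSpace ℝ (Fin 3),
      (⟪b₀, f⟫ = 1 ∧ ⟪b₀, c₁⟫ = 0 ∧ ⟪b₀, c₂⟫ = 0) ∧ (⟪b₁, f⟫ = 0 ∧ ⟪b₁, c₁⟫ = 1 ∧ ⟪b₁, c₂⟫ = 0) ∧
        (⟪b₂, f⟫ = 0 ∧ ⟪b₂, c₁⟫ = 0 ∧ ⟪b₂, c₂⟫ = 1) ∧ (‖b₀‖ ≤ 3 / 2 ∧ ‖b₁‖ ≤ 5 / 4 ∧ ‖b₂‖ ≤ 5 / 4) ∧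
          ∀ v, v = ⟪b₀, v⟫ • f + ⟪b₁, v⟫ • c₁ + ⟪b₂, v⟫ • c₂ := by
  obtain ⟨g, hgdef⟩ : ∃ g : ℝ, ⟪c₁, c₂⟫ = g := ⟨_, rfl⟩
  rw [hgdef] at hg
  have hg2 : 2 * g * g = g := by rcases hg with h | h <;> norm_num [h]
  have hg0 : 0 ≤ g := by rcases hg with h | h <;> norm_num [h]
  -- Gram values
  have hff : ⟪f, f⟫ = 1 := by rw [real_inner_self_eq_norm_sq, hf]; norm_num
  have h11 : ⟪c₁, c₁⟫ = 1 := by rw [real_inner_self_eq_norm_sq, hc₁]; norm_num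
  have h22 : ⟪c₂, c₂⟫ = 1 := by rw [real_inner_self_eq_norm_sq, hc₂]; norm_num
  have h1f : ⟪c₁, f⟫ = 1 / 2 := real_inner_eq_half hc₁ hf hc₁f
  have h2f : ⟪c₂, f⟫ = 1 / 2 := real_inner_eq_half hc₂ hf hc₂f
  have hf1 : ⟪f, c₁⟫ = 1 / 2 := by rw [real_inner_comm]; exact h1f
  have hf2 : ⟪f, c₂⟫ = 1 / 2 := by rw [real_inner_comm]; exact h2f
  have h12 : ⟪c₁, c₂⟫ = g := hgdef
  have h21 : ⟪c₂, c₁⟫ = g := by rw [real_inner_comm]; exact hgdef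
  -- the dual vectors
  obtain ⟨b₀, hb₀⟩ : ∃ b₀ : EuclideanSpace ℝ (Fin 3), b₀ = (2 - g) • f - (1 - g) • c₁ - (1 - g) • c₂ := ⟨_, rfl⟩
  obtain ⟨b₁, hb₁⟩ : ∃ b₁ : EuclideanSpace ℝ (Fin 3), b₁ = -(1 - g) • f + (3 / 2 : ℝ) • c₁ + (1 / 2 - 2 * g) • c₂ := ⟨_, rfl⟩
  obtain ⟨b₂, hb₂⟩ : ∃ b₂ : EuclideanSpace ℝ (Fin 3), b₂ = -(1 - g) • f + (1 / 2 - 2 * g) • c₁ + (3 / 2 : ℝ) • c₂ := ⟨_, rfl⟩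
  have d0f : ⟪b₀, f⟫ = 1 := by
    rw [hb₀]; simp only [inner_sub_left, real_inner_smul_left, hff, h1f, h2f]; ring
  have d01 : ⟪b₀, c₁⟫ = 0 := by
    rw [hb₀]; simp only [inner_sub_left, real_inner_smul_left, hf1, h11, h21]; linear_combination (1 / 2 : ℝ) * hg2
  have d02 : ⟪b₀, c₂⟫ = 0 := by
    rw [hb₀]; simp only [inner_sub_left, real_inner_smul_left, hf2, h12, h22]; linear_combination (1 / 2 : ℝ) * hg2
  have d1f : ⟪b₁, f⟫ = 0 := by
    rw [hb₁]; simp only [inner_add_left, real_inner_smul_left, hff, h1f, h2f]; ring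
  have d11 : ⟪b₁, c₁⟫ = 1 := by
    rw [hb₁]; simp only [inner_add_left, real_inner_smul_left, hf1, h11, h21]; linear_combination (-1 : ℝ) * hg2
  have d12 : ⟪b₁, c₂⟫ = 0 := by
    rw [hb₁]; simp only [inner_add_left, real_inner_smul_left, hf2, h12, h22]; ring
  have d2f : ⟪b₂, f⟫ = 0 := by
    rw [hb₂]; simp only [inner_add_left, real_inner_smul_left, hff, h1f, h2f]; ring
  have d21 : ⟪b₂, c₁⟫ = 0 := by
    rw [hb₂]; simp only [inner_add_left, real_inner_smul_left, hf1, h11, h21]; ring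
  have d22 : ⟪b₂, c₂⟫ = 1 := by
    rw [hb₂]; simp only [inner_add_left, real_inner_smul_left, hf2, h12, h22]; linear_combination (-1 : ℝ) * hg2
  -- their norms, from duality
  have n0 : ‖b₀‖ ^ 2 = 2 - g := by
    rw [← real_inner_self_eq_norm_sq]
    have hx : ⟪b₀, b₀⟫ = ⟪b₀, (2 - g) • f - (1 - g) • c₁ - (1 - g) • c₂⟫ := by rw [← hb₀]
    rw [hx]; simp only [inner_sub_right, real_inner_smul_right, d0f, d01, d02]; ring
  have n1 : ‖b₁‖ ^ 2 = 3 / 2 := by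
    rw [← real_inner_self_eq_norm_sq]
    have hx : ⟪b₁, b₁⟫ = ⟪b₁, -(1 - g) • f + (3 / 2 : ℝ) • c₁ + (1 / 2 - 2 * g) • c₂⟫ := by rw [← hb₁]
    rw [hx]; simp only [inner_add_right, real_inner_smul_right, d1f, d11, d12]; ring
  have n2 : ‖b₂‖ ^ 2 = 3 / 2 := by
    rw [← real_inner_self_eq_norm_sq]
    have hx : ⟪b₂, b₂⟫ = ⟪b₂, -(1 - g) • f + (1 / 2 - 2 * g) • c₁ + (3 / 2 : ℝ) • c₂⟫ := by rw [← hb₂]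
    rw [hx]; simp only [inner_add_right, real_inner_smul_right, d2f, d21, d22]; ring
  have e0 : ‖b₀‖ ≤ 3 / 2 := (abs_le_of_sq_le_sq' (by rw [n0]; nlinarith) (by norm_num)).2
  have e1 : ‖b₁‖ ≤ 5 / 4 := (abs_le_of_sq_le_sq' (by rw [n1]; norm_num) (by norm_num)).2
  have e2 : ‖b₂‖ ≤ 5 / 4 := (abs_le_of_sq_le_sq' (by rw [n2]; norm_num) (by norm_num)).2
  -- `(f, c₁, c₂)` is a basis and the duals are its coordinate functionals
  have hli : LinearIndependent ℝ ![f, c₁, c₂] := by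
    rw [Fintype.linearIndependent_iff]
    intro w hw
    have hw' : w 0 • f + w 1 • c₁ + w 2 • c₂ = 0 := by simpa [Fin.sum_univ_three] using hw
    have e0 : w 0 = 0 := by
      have := congrArg (fun x => ⟪b₀, x⟫) hw'
      simpa [inner_add_right, real_inner_smul_right, d0f, d01, d02] using this
    have e1 : w 1 = 0 := by
      have := congrArg (fun x => ⟪b₁, x⟫) hw'
      simpa [inner_add_right, real_inner_smul_right, d1f, d11, d12] using this
    have e2 : w 2 = 0 := by
      have := congrArg (fun x => ⟪b₂, x⟫) hw'
      simpa [inner_add_right, real_inner_smul_right, d2f, d21, d22] using this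
    intro i
    fin_cases i
    exacts [e0, e1, e2]
  have hspan : Submodule.span ℝ (Set.range ![f, c₁, c₂]) = ⊤ :=
    hli.span_eq_top_of_card_eq_finrank (by rw [finrank_euclideanSpace, Fintype.card_fin])
  refine ⟨b₀, b₁, b₂, ⟨d0f, d01, d02⟩, ⟨d1f, d11, d12⟩, ⟨d2f, d21, d22⟩, ⟨e0, e1, e2⟩, fun v => ?_⟩
  have hv : v ∈ Submodule.span ℝ (Set.range ![f, c₁, c₂]) := by rw [hspan]; exact Submodule.mem_top
  obtain ⟨w, hw⟩ := (Submodule.mem_span_range_iff_exists_fun ℝ).1 hv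
  have hw' : w 0 • f + w 1 • c₁ + w 2 • c₂ = v := by simpa [Fin.sum_univ_three] using hw
  have k0 : ⟪b₀, v⟫ = w 0 := by
    rw [← hw']; simp only [inner_add_right, real_inner_smul_right, d0f, d01, d02]; ring
  have k1 : ⟪b₁, v⟫ = w 1 := by
    rw [← hw']; simp only [inner_add_right, real_inner_smul_right, d1f, d11, d12]; ring
  have k2 : ⟪b₂, v⟫ = w 2 := by
    rw [← hw']; simp only [inner_add_right, real_inner_smul_right, d2f, d21, d22]; ring
  rw [k0, k1, k2, hw']

/-- **Half-frame conditioning.**  A linear map that is `η`-small on a half-frame is `4η`-small in operator norm. [this file] -/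
theorem halfFrame_opNorm_le {f c₁ c₂ : EuclideanSpace ℝ (Fin 3)} (hf : ‖f‖ = 1) (hc₁ : ‖c₁‖ = 1) (hc₂ : ‖c₂‖ = 1)
    (hc₁f : ‖c₁ - f‖ = 1) (hc₂f : ‖c₂ - f‖ = 1) (hg : ⟪c₁, c₂⟫ = 1 / 2 ∨ ⟪c₁, c₂⟫ = 0)
    (D : EuclideanSpace ℝ (Fin 3) →ₗ[ℝ] EuclideanSpace ℝ (Fin 3)) {η : ℝ} (h₀ : ‖D f‖ ≤ η) (h₁ : ‖D c₁‖ ≤ η)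
    (h₂ : ‖D c₂‖ ≤ η) (v : EuclideanSpace ℝ (Fin 3)) : ‖D v‖ ≤ 4 * η * ‖v‖ := by
  obtain ⟨b₀, b₁, b₂, -, -, -, ⟨e0, e1, e2⟩, hexp⟩ := halfFrame_duals hf hc₁ hc₂ hc₁f hc₂f hg
  have hη : 0 ≤ η := (norm_nonneg _).trans h₀
  have hDv : D v = ⟪b₀, v⟫ • D f + ⟪b₁, v⟫ • D c₁ + ⟪b₂, v⟫ • D c₂ := by
    conv_lhs => rw [hexp v]
    simp only [map_add, map_smul]
  rw [hDv]
  have i0 : |⟪b₀, v⟫| ≤ 3 / 2 * ‖v‖ := (abs_real_inner_le_norm _ _).trans (mul_le_mul_of_nonneg_right e0 (norm_nonneg v))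
  have i1 : |⟪b₁, v⟫| ≤ 5 / 4 * ‖v‖ := (abs_real_inner_le_norm _ _).trans (mul_le_mul_of_nonneg_right e1 (norm_nonneg v))
  have i2 : |⟪b₂, v⟫| ≤ 5 / 4 * ‖v‖ := (abs_real_inner_le_norm _ _).trans (mul_le_mul_of_nonneg_right e2 (norm_nonneg v))
  have p0 : |⟪b₀, v⟫| * ‖D f‖ ≤ 3 / 2 * ‖v‖ * η := mul_le_mul i0 h₀ (norm_nonneg _) (by positivity)
  have p1 : |⟪b₁, v⟫| * ‖D c₁‖ ≤ 5 / 4 * ‖v‖ * η := mul_le_mul i1 h₁ (norm_nonneg _) (by positivity)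
  have p2 : |⟪b₂, v⟫| * ‖D c₂‖ ≤ 5 / 4 * ‖v‖ * η := mul_le_mul i2 h₂ (norm_nonneg _) (by positivity)
  calc ‖⟪b₀, v⟫ • D f + ⟪b₁, v⟫ • D c₁ + ⟪b₂, v⟫ • D c₂‖
      ≤ ‖⟪b₀, v⟫ • D f‖ + ‖⟪b₁, v⟫ • D c₁‖ + ‖⟪b₂, v⟫ • D c₂‖ := norm_add₃_le
    _ = |⟪b₀, v⟫| * ‖D f‖ + |⟪b₁, v⟫| * ‖D c₁‖ + |⟪b₂, v⟫| * ‖D c₂‖ := by simp only [norm_smul, Real.norm_eq_abs]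
    _ ≤ 4 * η * ‖v‖ := by linarith

/-- **FRAME holds.** [this file; g59 memo §3] -/
theorem frameRealisation_holds : FrameRealisation := by
  intro f c₁ c₂ hf hc₁ hc₂ hc₁f hc₂f hg L t₀ t₁ t₂ η h₀ h₁ h₂
  obtain ⟨b₀, b₁, b₂, ⟨d0f, d01, d02⟩, ⟨d1f, d11, d12⟩, ⟨d2f, d21, d22⟩, -, -⟩ := halfFrame_duals hf hc₁ hc₂ hc₁f hc₂f hg
  refine ⟨L + dualSmul b₀ (t₀ - L f) + dualSmul b₁ (t₁ - L c₁) + dualSmul b₂ (t₂ - L c₂), ?_, ?_, ?_, ?_⟩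
  · simp only [LinearMap.add_apply, dualSmul_apply, d0f, d1f, d2f, one_smul, zero_smul, add_zero]; abel
  · simp only [LinearMap.add_apply, dualSmul_apply, d01, d11, d21, one_smul, zero_smul, add_zero]; abel
  · simp only [LinearMap.add_apply, dualSmul_apply, d02, d12, d22, one_smul, zero_smul, add_zero]; abel
  · intro v
    have key := halfFrame_opNorm_le hf hc₁ hc₂ hc₁f hc₂f hg
      (dualSmul b₀ (t₀ - L f) + dualSmul b₁ (t₁ - L c₁) + dualSmul b₂ (t₂ - L c₂)) (η := η)
      (by simp only [LinearMap.add_apply, dualSmul_apply, d0f, d1f, d2f, one_smul, zero_smul, add_zero]; rw [norm_sub_rev]; exact h₀)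
      (by simp only [LinearMap.add_apply, dualSmul_apply, d01, d11, d21, one_smul, zero_smul, add_zero, zero_add]
          rw [norm_sub_rev]; exact h₁)
      (by simp only [LinearMap.add_apply, dualSmul_apply, d02, d12, d22, one_smul, zero_smul, add_zero, zero_add]
          rw [norm_sub_rev]; exact h₂) v
    have hsub : (L + dualSmul b₀ (t₀ - L f) + dualSmul b₁ (t₁ - L c₁) + dualSmul b₂ (t₂ - L c₂)) v - L v =
        (dualSmul b₀ (t₀ - L f) + dualSmul b₁ (t₁ - L c₁) + dualSmul b₂ (t₂ - L c₂)) v := by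
      simp only [LinearMap.add_apply]; abel
    rw [hsub]; exact key

/-- **Near-conformality transfers along FRAME.**  If `‖L v − s Q v‖ ≤ τ s ‖v‖` and `‖M v − L v‖ ≤ 4η‖v‖` with `4η ≤ (1/5 − τ) s`, then `M`
is `1/5`-near-conformal in the sense of `snapRigidity_pair`. [this file] -/
theorem nearConformal_of_frame {L M : EuclideanSpace ℝ (Fin 3) →ₗ[ℝ] EuclideanSpace ℝ (Fin 3)}
    {Q : EuclideanSpace ℝ (Fin 3) →ₗᵢ[ℝ] EuclideanSpace ℝ (Fin 3)} {s τ η : ℝ} (hs : 0 < s)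
    (hL : ∀ v, ‖L v - s • Q v‖ ≤ τ * s * ‖v‖) (hM : ∀ v, ‖M v - L v‖ ≤ 4 * η * ‖v‖) (hητ : 4 * η ≤ (1 / 5 - τ) * s) :
    ∃ (Q' : EuclideanSpace ℝ (Fin 3) →ₗᵢ[ℝ] EuclideanSpace ℝ (Fin 3)) (s' : ℝ), 0 < s' ∧
      ∀ v, ‖M v - s' • Q' v‖ ≤ 1 / 5 * s' * ‖v‖ := by
  refine ⟨Q, s, hs, fun v => ?_⟩
  have h1 : ‖M v - s • Q v‖ ≤ ‖M v - L v‖ + ‖L v - s • Q v‖ := by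
    have : M v - s • Q v = (M v - L v) + (L v - s • Q v) := by abel
    rw [this]; exact norm_add_le _ _
  have h2 := hM v
  have h3 := hL v
  nlinarith [norm_nonneg v]

end Summit.AtomisticToContinuum.Crystallization.Theorems.OverbindingBudgetAffineFarSmoothSplit
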